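import Mathlib
import HarnessLib
import Literature.Analysis.FluidPDE.TypeIRateOseenMildRepresentative
import Literature.Analysis.FluidPDE.LocalTypeILiouville
import Summits.NavierStokesRegularity.NavierStokesRegularity.Theses.SymmetryModuliCount
import Summits.NavierStokesRegularity.NavierStokesRegularity.Theses.RecurrentProfiles
import Summits.NavierStokesRegularity.NavierStokesRegularity.Theses.DulacContraction
import Summits.NavierStokesRegularity.NavierStokesRegularity.Theorems.SqueezeCycleExtremalElementExistsRegularity
import Summits.NavierStokesRegularity.NavierStokesRegularity.Theorems.SqueezeCycleExtremalBiaxialitySubcriticalIffRecurrentLiouville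
import Summits.NavierStokesRegularity.NavierStokesRegularity.Theorems.SymmetryModuliCountForcedSymmetryStubSlabProfileOfNonzero
import Summits.NavierStokesRegularity.NavierStokesRegularity.Theorems.SymmetryModuliCountForcedSymmetryCollapse

/-!
# Crux `ForcedSymmetry` (stmt-NavierStokesRegularity-4052): the two Type-I classes coincide —
# `X = TypeIAncientLiouville` IS `NoTypeIRateProfile` (stmt-1588), `RecurrentLiouville` (stmt-1589),
# `SqueezeLiouville` (stmt-11608), `ExtremalBiaxialitySubcritical` (stmt-11609), the RellichScar pair

Route `SymmetryModuliCount`, sub-problem `NavierStokesRegularity`.  Lead seat c3 (2026-08-17), line `recurrent-closing`.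

Two classes of Type-I objects live in the tree: the KNSS-gauge class `A_C` (`IsTypeIAncientMild C u`: smooth on `t < 0`,
divergence free, KNSS-mild, rate `‖u‖ ≤ C/√(−t)`; the class of this route's target `X`) and Albritton–Barker's slab class
𝒦 (suitable weak on `ℝ³ × (−∞,0)` with weak gradient, `𝐈 < ∞`, the same rate; the class of `RecurrentProfiles`,
`DulacContraction`, `RellichScar`).  The bridge of the line `recurrent-closing` (`slabProfile_of_isTypeIAncientMild`,
`stub_slabProfileOfNonzero`) gives `A_C ⊂ 𝒦`; the Literature theorem `exists_oseenMild_repr_of_typeIBound_lt_top`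
(KNSS Lemma 3.1 + A–B `𝐈`) with `isTypeIAncientMild_of_continuous_oseenMild` (KNSS Prop. 4.1) gives `𝒦 ⊂ A_C` up to a.e.
equality on the slab.  Consequently the Liouville statements over the two classes are ONE statement:

* `exists_isTypeIAncientMild_repr_of_slabProfile` — `𝒦 ∋ u ⇒ u = v` a.e. with `v ∈ A_C`;
* `typeIAncientLiouville_iff_noTypeIRateProfile` — `X ↔ NoTypeIRateProfile` (stmt-4050 ↔ stmt-1588);
* `typeIAncientLiouville_iff_recurrentLiouville`, `typeIAncientLiouville_iff_squeezeLiouville`,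
  `forcedSymmetry_iff_noTypeIRateProfile`, `forcedSymmetry_iff_recurrentLiouville`,
  `forcedSymmetry_iff_extremalBiaxialitySubcritical`, `forcedSymmetry_iff_rellichScar` — the web, through the landed
  `recurrentLiouville_iff_noTypeIRateProfile`, `squeezeLiouville_iff_noTypeIRateProfile`, … and the collapse
  `forcedSymmetry_iff_typeIAncientLiouville`;
* `recurrentLiouville_of_recurrentClosing` — the two research stubs of the line give stmt-1589 directly:
  `RecurrentClosing → RDSSLiouvilleInClass → RecurrentLiouville` (for the gen-4 stub `RecurrentClosingWeak` compose with
  `recurrentClosing_of_recurrentClosingWeak` of the residual file).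

So after this file the cruxes/targets 4052, 4050 (SymmetryModuliCount), 1588, 1589 (RecurrentProfiles, DulacContraction),
11608, 11609 (SqueezeCycle) and 11716 ∧ 11719 (RellichScar) are kernel-checked EQUIVALENT.

References: D. Albritton, T. Barker, J. Math. Fluid Mech. 21 (2019) = arXiv:1811.00502, Thm 1.1, Lemma 2.2, Prop. 2.3,
Remark 3.2, §3 [AlbrittonBarker2019]; G. Koch, N. Nadirashvili, G. Seregin, V. Šverák, Acta Math. 203 (2009), Lemma 3.1,
Prop. 4.1 [KochNadirashviliSereginSverak2009].
-/

noncomputable section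

-- the summit and its single problem share the name (D-0017 nested layout)
set_option linter.dupNamespace false

open MeasureTheory Set Function Filter Metric
open scoped ENNReal NNReal
open Literature.Analysis.FluidPDE
open Summit.NavierStokesRegularity.NavierStokesRegularity.Theses
open Summit.NavierStokesRegularity.NavierStokesRegularity.Theses.SymmetryModuliCount

namespace Summit.NavierStokesRegularity.NavierStokesRegularity.Theorems.SymmetryModuliCountForcedSymmetry

/-! ### `𝒦 ⊂ A_C` up to a.e. equality -/

/-- **A Type-I-rate slab profile with `𝐈 < ∞` is a.e. an element of `A_C`.**  If `(u, p)` is a suitable weak solution on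
`ℝ³ × (−∞,0)` with `𝐈 < ∞` (any weak gradient `G`) and `‖u t x‖ ≤ C/√(−t)`, then `u = v` a.e. on the slab for some
`v ∈ A_C` (`IsTypeIAncientMild C v`): the continuous Oseen-mild representative of
`exists_oseenMild_repr_of_typeIBound_lt_top` is KNSS-mild and smooth (`isTypeIAncientMild_of_continuous_oseenMild`).
[cite: AlbrittonBarker2019, Thm 1.1 (forward direction), §3; KochNadirashviliSereginSverak2009, Lemma 3.1, Prop. 4.1] -/
theorem exists_isTypeIAncientMild_repr_of_slabProfile
    {u : ℝ → EuclideanSpace ℝ (Fin 3) → EuclideanSpace ℝ (Fin 3)} {p : ℝ → EuclideanSpace ℝ (Fin 3) → ℝ}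
    {G : ℝ → EuclideanSpace ℝ (Fin 3) → EuclideanSpace ℝ (Fin 3) →L[ℝ] EuclideanSpace ℝ (Fin 3)} {C : ℝ}
    (hsw : IsSuitableWeakSolutionOn (slab (EuclideanSpace ℝ (Fin 3)) (Iio (0 : ℝ)) isOpen_Iio) 1 0 u p)
    (hdec : HasTypeITimeDecay C u)
    (hI : typeIBound (Iio (0 : ℝ) ×ˢ (univ : Set (EuclideanSpace ℝ (Fin 3)))) u p G < ⊤) :
    ∃ v : ℝ → EuclideanSpace ℝ (Fin 3) → EuclideanSpace ℝ (Fin 3), IsTypeIAncientMild C v ∧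
      (∀ᵐ w ∂(volume.restrict (Iio (0 : ℝ) ×ˢ (univ : Set (EuclideanSpace ℝ (Fin 3))))), uncurry u w = uncurry v w) := by
  obtain ⟨v, hae, hvc, hvd, hvm, hvC⟩ := exists_oseenMild_repr_of_typeIBound_lt_top hsw hdec hI
  exact ⟨v, isTypeIAncientMild_of_continuous_oseenMild hvc hvd hvm hvC, hae⟩

/-! ### `X ↔ NoTypeIRateProfile` -/

/-- **`X → NoTypeIRateProfile`** (stmt-4050 ⇒ stmt-1588): a singular Type-I-rate slab profile with `𝐈 < ∞` is a.e. an
element of `A_C`, which `X` annihilates; a field vanishing a.e. on the slab is essentially bounded on `Q(0,1)`.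
[cite: AlbrittonBarker2019, Thm 1.1, §3] -/
theorem noTypeIRateProfile_of_typeIAncientLiouville (hX : TypeIAncientLiouville) :
    RecurrentProfiles.NoTypeIRateProfile := by
  intro u p G C hsw hwg hI hdec hsing
  obtain ⟨v, hv, hae⟩ := exists_isTypeIAncientMild_repr_of_slabProfile hsw hdec hI
  have hzero : ∀ t < 0, ∀ x, v t x = 0 := hX C v (isTypeIAncientMild_iff.1 hv)
  have hu0 : ∀ᵐ w ∂(volume.restrict (Iio (0 : ℝ) ×ˢ (univ : Set (EuclideanSpace ℝ (Fin 3))))),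
      uncurry u w = (0 : ℝ × EuclideanSpace ℝ (Fin 3) → EuclideanSpace ℝ (Fin 3)) w := by
    filter_upwards [hae, ae_restrict_mem (measurableSet_Iio.prod MeasurableSet.univ)] with w hw hwm
    rw [hw]
    exact hzero w.1 hwm.1 w.2
  have h1c := hsing 1 one_pos
  have hsub : parabolicCylinder 1 (0 : ℝ × EuclideanSpace ℝ (Fin 3)) ⊆
      Iio (0 : ℝ) ×ˢ (univ : Set (EuclideanSpace ℝ (Fin 3))) :=
    parabolicCylinder_origin_subset_slab 1
  have h0 : eLpNorm (uncurry u) ∞ (volume.restrict (parabolicCylinder 1 (0 : ℝ × EuclideanSpace ℝ (Fin 3)))) = 0 := by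
    rw [eLpNorm_congr_ae (ae_restrict_of_ae_restrict_of_subset hsub hu0)]
    exact eLpNorm_zero
  rw [h0] at h1c
  exact ENNReal.zero_ne_top h1c

/-- **`NoTypeIRateProfile → X`** (stmt-1588 ⇒ stmt-4050): a nonzero element of `A_C` yields, by the bridge
`stub_slabProfileOfNonzero` (blow-down + `A_C ⊂ 𝒦`), a singular Type-I-rate slab profile. [cite: AlbrittonBarker2019, Lemma 2.2, Prop. 2.3, §3] -/
theorem typeIAncientLiouville_of_noTypeIRateProfile (h : RecurrentProfiles.NoTypeIRateProfile) :
    TypeIAncientLiouville := by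
  intro C u hu t ht x
  by_contra hx
  have hu' : IsTypeIAncientMild C u := isTypeIAncientMild_iff.2 hu
  obtain ⟨w, q, G, C', hsw, hwg, hI, hdec, hsing⟩ := stub_slabProfileOfNonzero C u hu' ⟨t, ht, x, hx⟩
  exact h w q G C' hsw hwg hI hdec hsing

/-- **`X ↔ NoTypeIRateProfile`**: Type-I Liouville in the KNSS gauge class `A_C` (route `SymmetryModuliCount`, stmt-4050)
and "no Type-I-rate singular profile in Albritton–Barker's slab class" (routes `RecurrentProfiles`/`DulacContraction`,
stmt-1588) are the same statement. [cite: AlbrittonBarker2019, Thm 1.1, §3] -/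
theorem typeIAncientLiouville_iff_noTypeIRateProfile :
    TypeIAncientLiouville ↔ RecurrentProfiles.NoTypeIRateProfile :=
  ⟨noTypeIRateProfile_of_typeIAncientLiouville, typeIAncientLiouville_of_noTypeIRateProfile⟩

/-! ### The web of equivalent cruxes -/

/-- **`X ↔ RecurrentLiouville`** (stmt-4050 ↔ stmt-1589), through `recurrentLiouville_iff_noTypeIRateProfile`
(recurrence is not load-bearing). [cite: AlbrittonBarker2019, Thm 1.1, §3] -/
theorem typeIAncientLiouville_iff_recurrentLiouville :
    TypeIAncientLiouville ↔ RecurrentProfiles.RecurrentLiouville :=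
  typeIAncientLiouville_iff_noTypeIRateProfile.trans recurrentLiouville_iff_noTypeIRateProfile.symm

/-- **`X ↔ SqueezeLiouville`** (stmt-4050 ↔ stmt-11608): Liouville over `A_C` and over SqueezeCycle's Morrey class `𝒦_C`
coincide. [cite: AlbrittonBarker2019, Thm 1.1, §3] -/
theorem typeIAncientLiouville_iff_squeezeLiouville :
    TypeIAncientLiouville ↔ SqueezeCycle.SqueezeLiouville :=
  typeIAncientLiouville_iff_noTypeIRateProfile.trans squeezeLiouville_iff_noTypeIRateProfile.symm

/-- **The crux ↔ `NoTypeIRateProfile`** (stmt-4052 ↔ stmt-1588). [cite: AlbrittonBarker2019, Thm 1.1, §3] -/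
theorem forcedSymmetry_iff_noTypeIRateProfile : ForcedSymmetry ↔ RecurrentProfiles.NoTypeIRateProfile :=
  forcedSymmetry_iff_typeIAncientLiouville.trans typeIAncientLiouville_iff_noTypeIRateProfile

/-- **The crux ↔ `RecurrentLiouville`** (stmt-4052 ↔ stmt-1589). [cite: AlbrittonBarker2019, Thm 1.1, §3] -/
theorem forcedSymmetry_iff_recurrentLiouville : ForcedSymmetry ↔ RecurrentProfiles.RecurrentLiouville :=
  forcedSymmetry_iff_typeIAncientLiouville.trans typeIAncientLiouville_iff_recurrentLiouville

/-- **The crux ↔ `ExtremalBiaxialitySubcritical`** (stmt-4052 ↔ stmt-11609). [cite: AlbrittonBarker2019, Thm 1.1, §3] -/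
theorem forcedSymmetry_iff_extremalBiaxialitySubcritical :
    ForcedSymmetry ↔ SqueezeCycle.ExtremalBiaxialitySubcritical :=
  forcedSymmetry_iff_noTypeIRateProfile.trans extremalBiaxialitySubcritical_iff_noTypeIRateProfile.symm

/-- **The crux ↔ the RellichScar pair** (stmt-4052 ↔ stmt-11716 ∧ stmt-11719). [cite: AlbrittonBarker2019, Thm 1.1, §3] -/
theorem forcedSymmetry_iff_rellichScar :
    ForcedSymmetry ↔ (RellichScar.NoApexTypeIProfile ∧ RellichScar.ApexLocalisation) :=
  forcedSymmetry_iff_extremalBiaxialitySubcritical.trans extremalBiaxialitySubcritical_iff_rellichScar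

/-! ### The two research stubs of the line give `RecurrentLiouville` directly -/

/-- **`RecurrentClosing → RDSSLiouvilleInClass → RecurrentLiouville`** (the factorisation of stmt-1589 carried by the line
`recurrent-closing`; `h₂` is verbatim the registered stub `stub_recurrentClosing`): a uniformly recurrent singular profile
would be accompanied by an RDSS singular smooth one, which stmt-8561 declares regular at the origin. [cite: AlbrittonBarker2019, Thm 1.1; census §D5] -/
theorem recurrentLiouville_of_recurrentClosing
    (h₂ : ∀ (u : ℝ → EuclideanSpace ℝ (Fin 3) → EuclideanSpace ℝ (Fin 3)) (p : ℝ → EuclideanSpace ℝ (Fin 3) → ℝ)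
      (G : ℝ → EuclideanSpace ℝ (Fin 3) → EuclideanSpace ℝ (Fin 3) →L[ℝ] EuclideanSpace ℝ (Fin 3)) (C : ℝ),
      Literature.Analysis.FluidPDE.IsSuitableWeakSolutionOn
          (Literature.Analysis.FluidPDE.slab (EuclideanSpace ℝ (Fin 3)) (Set.Iio 0) isOpen_Iio) 1 0 u p →
      Literature.Analysis.FluidPDE.HasWeakSpatialGradientOn
          (Literature.Analysis.FluidPDE.slab (EuclideanSpace ℝ (Fin 3)) (Set.Iio 0) isOpen_Iio) u G →
      Literature.Analysis.FluidPDE.typeIBound (Set.Iio (0 : ℝ) ×ˢ Set.univ) u p G < ⊤ →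
      Literature.Analysis.FluidPDE.HasTypeITimeDecay C u →
      (∀ ε : ℝ, 0 < ε → ∀ K : Set (ℝ × EuclideanSpace ℝ (Fin 3)), IsCompact K → K ⊆ Set.Iic (0 : ℝ) ×ˢ Set.univ →
        ∃ L : ℝ, 0 < L ∧ ∀ a : ℝ, ∃ σ ∈ Set.Icc a (a + L),
          MeasureTheory.eLpNorm (fun z : ℝ × EuclideanSpace ℝ (Fin 3) =>
            Literature.Analysis.FluidPDE.nsRescale (Real.exp σ) u z.1 z.2 - u z.1 z.2) 3
            (MeasureTheory.volume.restrict K) ≤ ENNReal.ofReal ε) →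
      Literature.Analysis.FluidPDE.IsBackwardSingularPoint u 0 →
      ∃ (w : ℝ → EuclideanSpace ℝ (Fin 3) → EuclideanSpace ℝ (Fin 3)) (q : ℝ → EuclideanSpace ℝ (Fin 3) → ℝ)
        (H : ℝ → EuclideanSpace ℝ (Fin 3) → EuclideanSpace ℝ (Fin 3) →L[ℝ] EuclideanSpace ℝ (Fin 3)) (C' : ℝ),
        Literature.Analysis.FluidPDE.IsSuitableWeakSolutionOn
            (Literature.Analysis.FluidPDE.slab (EuclideanSpace ℝ (Fin 3)) (Set.Iio 0) isOpen_Iio) 1 0 w q ∧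
        Literature.Analysis.FluidPDE.HasWeakSpatialGradientOn
            (Literature.Analysis.FluidPDE.slab (EuclideanSpace ℝ (Fin 3)) (Set.Iio 0) isOpen_Iio) w H ∧
        Literature.Analysis.FluidPDE.typeIBound (Set.Iio (0 : ℝ) ×ˢ Set.univ) w q H < ⊤ ∧
        Literature.Analysis.FluidPDE.HasTypeITimeDecay C' w ∧
        Literature.Analysis.FluidPDE.IsClassicalNSSolutionOn (Set.Iio 0) 1 0 w q ∧
        (∃ l : ℝ, 1 < l ∧ ∃ (R : EuclideanSpace ℝ (Fin 3) ≃ₗᵢ[ℝ] EuclideanSpace ℝ (Fin 3))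
            (ξ : EuclideanSpace ℝ (Fin 3)) (τ : ℝ), τ ≤ 0 ∧
            (fun z : ℝ × EuclideanSpace ℝ (Fin 3) => l • R.symm (w (l ^ 2 * z.1 + τ) (l • R z.2 + ξ)))
              =ᵐ[MeasureTheory.volume.restrict (Set.Iio (0 : ℝ) ×ˢ Set.univ)]
            (fun z : ℝ × EuclideanSpace ℝ (Fin 3) => w z.1 z.2)) ∧
        Literature.Analysis.FluidPDE.IsBackwardSingularPoint w 0)
    (h₃ : DulacContraction.RDSSLiouvilleInClass) : RecurrentProfiles.RecurrentLiouville := by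
  intro u p G C hsw hwg hI hdec hrec hsing
  obtain ⟨w, q, H, C', hw, hH, hIw, hCw, hcl, hrdss, hsingw⟩ := h₂ u p G C hsw hwg hI hdec hrec hsing
  exact h₃ w q H C' hw hH hIw hCw hcl hrdss hsingw

end Summit.NavierStokesRegularity.NavierStokesRegularity.Theorems.SymmetryModuliCountForcedSymmetry

end
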